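import Mathlib.Analysis.SpecialFunctions.Pow.Real
import Mathlib.Analysis.SpecialFunctions.Log.Basic
import Mathlib.Analysis.MeanInequalitiesPow
import HarnessLib

/-!
# Soft extrema of the registered relay objective: the power-mean soft minimum and the log-mean-exp soft maximum

Cell `pub-fluidc` (FLUID COMPUTER; host summit `NavierStokesRegularity`, negation side, machine paradigm), prover
seat p1 (gen 6); companion to `FluidComputer.RelayBudget` (the two-octave budget `Q₂ = λ² r₁ r₂` and the relay
inequality for the TRUE minimum) and `FluidComputer.AmplitudeLedger`. HONEST FRAMING: low prior, high
value-of-information experiment on Tao's machine paradigm; NOT a claim that NS blows up. Nothing in this file is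
about the Navier–Stokes equations: these are elementary facts about two smooth surrogates of `min` and `max` on `ℝ`.

The cell's registered two-level RELAY objective (opt-adj `optadj_ext.twolevel`, `bandsup_relay_lse`, RULING R35 row (d),
RULING R44 (ii)(b) design (b) `R3D-128-band34-relay-p12-rho3-T3-ws-1`, kit j215197) is NOT the minimum of the two level
ratios but a smooth surrogate an adjoint optimiser can ascend:
`J = PM₋q(ρ₁, ρ₂) = ((ρ₁^{-q} + ρ₂^{-q})/2)^{-1/q}` with `q = 12`, where each `ρᵢ` is itself built from a
LOG-MEAN-EXP in time (inverse temperature `β`) of spatial `Lᵖ` band norms. Every `result.json` of that plugin prints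
`J_over_min = J / min(ρ₁, ρ₂)` next to `pm_bracket_q = 2^{1/q}`; this file types the two brackets those keys rely on:

* `softMin q a b` — the power mean of order `-q`; for `0 < q`, `0 < a`, `0 < b`:
  `min_le_softMin` / `softMin_le_max` (it is a mean), `softMin_le_mul_min` (`≤ 2^{1/q} · min`),
  `softMin_div_min_mem_Icc` (`J / min ∈ [1, 2^{1/q}]` — the printed bracket), `le_min_of_le_softMin` (the reading
  direction: a certified value `x ≤ J` certifies `x / 2^{1/q} ≤ min(ρ₁, ρ₂)`), `softMin_self`, `softMin_comm`,
  `softMin_mono_left/right` (ascending either ratio ascends `J`), `softMin_mul` (degree-one homogeneity);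
* `logMeanExp β s f = log((∑_{i∈s} exp(β fᵢ)) / #s) / β` — the normalised log-sum-exp; for `0 < β`, `s` nonempty:
  `logMeanExp_le_sup'` (`≤ max`) and `sup'_sub_le_logMeanExp` (`≥ max − log #s / β`), `logMeanExp_mono`,
  `logMeanExp_const`;
* `two_rpow_one_div_twelve_lt` — the numeric anchor `2^{1/12} < 1.06` (opt-adj prints 1.05946…), so at the registered
  `q = 12` the soft minimum over-states the smaller smooth ratio by less than 6 %: design (b)'s `J = 0.56464` with
  `min(ρ₁, ρ₂) = 0.55071` (`J_over_min = 1.0253`) sits inside the bracket, as it must.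

What is NOT here (read on the runs, never derived): the passage from the SMOOTH ratios `ρᵢ` (time-soft-max of `Lᵖ`
norms) to the SUP ratios `r₁, r₂` of the K-P3-2 / K-P3-3 letter (true band sups at their own peaks) — that needs the
peak factors `‖·‖_∞ / ‖·‖_p` of the particular fields, which differ between numerator and denominator bands, so no
one-sided inequality between `J` and `min(r₁, r₂)` holds in general (design (b): `r₁ 0.817`, `r₂ 0.678` vs
`ρ₁ 0.551`, `ρ₂ 0.585`).

0 sorry; axioms ⊆ {propext, Classical.choice, Quot.sound}; no named fact introduced.
-/

noncomputable section

namespace Summit.NavierStokesRegularity.FluidComputer.SoftExtrema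

open Real Finset

/-! ## The soft minimum of order `q` (negative power mean of two positive reals) -/

/-- The power mean of order `-q` of two reals, `softMin q a b = ((a^{-q} + b^{-q}) / 2)^{-1/q}` — the registered
relay form `PM₋q(ρ₁, ρ₂)` (`q = 12` in the cell). Meaningful for `0 < q`, `0 < a`, `0 < b`. -/
def softMin (q a b : ℝ) : ℝ := ((a ^ (-q) + b ^ (-q)) / 2) ^ (-(1 / q))

/-- The soft minimum is symmetric. -/
theorem softMin_comm (q a b : ℝ) : softMin q a b = softMin q b a := by
  simp only [softMin, add_comm]

/-- The exponent bookkeeping behind every bracket below: `(a^{-q})^{-1/q} = a` for `q ≠ 0`, `0 ≤ a`. -/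
theorem rpow_neg_rpow_neg_one_div {q a : ℝ} (hq : q ≠ 0) (ha : 0 ≤ a) :
    (a ^ (-q)) ^ (-(1 / q)) = a := by
  rw [← Real.rpow_mul ha]
  have h : -q * -(1 / q) = 1 := by field_simp
  rw [h, Real.rpow_one]

/-- On the diagonal the soft minimum is exact: `softMin q a a = a`. -/
theorem softMin_self {q a : ℝ} (hq : q ≠ 0) (ha : 0 ≤ a) : softMin q a a = a := by
  simp only [softMin]
  rw [show (a ^ (-q) + a ^ (-q)) / 2 = a ^ (-q) by ring]
  exact rpow_neg_rpow_neg_one_div hq ha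

/-- The soft minimum of positive reals is positive (for any real order `q`). -/
theorem softMin_pos (q : ℝ) {a b : ℝ} (ha : 0 < a) (hb : 0 < b) : 0 < softMin q a b := by
  unfold softMin
  have hA : 0 < a ^ (-q) := Real.rpow_pos_of_pos ha _
  have hB : 0 < b ^ (-q) := Real.rpow_pos_of_pos hb _
  exact Real.rpow_pos_of_pos (by positivity) _

/-- Ordered form of the bracket: for `0 < a ≤ b`, `a ≤ softMin q a b ≤ b` and `softMin q a b ≤ 2^{1/q} · a`. -/
theorem softMin_bracket_of_le {q a b : ℝ} (hq : 0 < q) (ha : 0 < a) (hab : a ≤ b) :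
    a ≤ softMin q a b ∧ softMin q a b ≤ b ∧ softMin q a b ≤ 2 ^ (1 / q) * a := by
  have hb : 0 < b := lt_of_lt_of_le ha hab
  have hz : -(1 / q) ≤ 0 := by
    have : 0 < 1 / q := by positivity
    linarith
  set A := a ^ (-q) with hAdef
  set B := b ^ (-q) with hBdef
  have hA : 0 < A := Real.rpow_pos_of_pos ha _
  have hB : 0 < B := Real.rpow_pos_of_pos hb _
  -- negative powers reverse the order: `b^{-q} ≤ a^{-q}`
  have hBA : B ≤ A := Real.rpow_le_rpow_of_nonpos ha hab (by linarith)
  set m := (A + B) / 2 with hmdef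
  have hm : 0 < m := by positivity
  have hmA : m ≤ A := by rw [hmdef]; linarith
  have hBm : B ≤ m := by rw [hmdef]; linarith
  have hA2m : A / 2 ≤ m := by rw [hmdef]; linarith [hB.le]
  have hsm : softMin q a b = m ^ (-(1 / q)) := rfl
  have hAa : A ^ (-(1 / q)) = a := rpow_neg_rpow_neg_one_div hq.ne' ha.le
  have hBb : B ^ (-(1 / q)) = b := rpow_neg_rpow_neg_one_div hq.ne' hb.le
  refine ⟨?_, ?_, ?_⟩
  · -- `m ≤ A` and the exponent is nonpositive ⇒ `A^z ≤ m^z`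
    rw [hsm, ← hAa]
    exact Real.rpow_le_rpow_of_nonpos hm hmA hz
  · rw [hsm, ← hBb]
    exact Real.rpow_le_rpow_of_nonpos hB hBm hz
  · -- `A/2 ≤ m` ⇒ `m^z ≤ (A/2)^z = A^z / 2^z = a · 2^{1/q}`
    have h1 : m ^ (-(1 / q)) ≤ (A / 2) ^ (-(1 / q)) :=
      Real.rpow_le_rpow_of_nonpos (by positivity) hA2m hz
    have h2 : (A / 2) ^ (-(1 / q)) = 2 ^ (1 / q) * a := by
      rw [Real.div_rpow hA.le (by norm_num : (0:ℝ) ≤ 2), hAa,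
        Real.rpow_neg (by norm_num : (0:ℝ) ≤ 2), div_eq_mul_inv, inv_inv, mul_comm]
    rw [hsm]
    exact h1.trans_eq h2

/-- The soft minimum is at least the minimum (it is a mean): `min a b ≤ softMin q a b`. -/
theorem min_le_softMin {q a b : ℝ} (hq : 0 < q) (ha : 0 < a) (hb : 0 < b) :
    min a b ≤ softMin q a b := by
  rcases le_total a b with hab | hba
  · rw [min_eq_left hab]
    exact (softMin_bracket_of_le hq ha hab).1
  · rw [min_eq_right hba, softMin_comm]
    exact (softMin_bracket_of_le hq hb hba).1

/-- The soft minimum is at most the maximum (it is a mean): `softMin q a b ≤ max a b`. -/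
theorem softMin_le_max {q a b : ℝ} (hq : 0 < q) (ha : 0 < a) (hb : 0 < b) :
    softMin q a b ≤ max a b := by
  rcases le_total a b with hab | hba
  · rw [max_eq_right hab]
    exact (softMin_bracket_of_le hq ha hab).2.1
  · rw [max_eq_left hba, softMin_comm]
    exact (softMin_bracket_of_le hq hb hba).2.1

/-- The printed bracket `pm_bracket_q`: `softMin q a b ≤ 2^{1/q} · min a b` — the soft minimum over-states the
smaller argument by at most the factor `2^{1/q}` (equality iff the larger argument is infinite). -/
theorem softMin_le_mul_min {q a b : ℝ} (hq : 0 < q) (ha : 0 < a) (hb : 0 < b) :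
    softMin q a b ≤ 2 ^ (1 / q) * min a b := by
  rcases le_total a b with hab | hba
  · rw [min_eq_left hab]
    exact (softMin_bracket_of_le hq ha hab).2.2
  · rw [min_eq_right hba, softMin_comm]
    exact (softMin_bracket_of_le hq hb hba).2.2

/-- The `J_over_min` key of the relay plugin lies in `[1, 2^{1/q}]`:
`softMin q a b / min a b ∈ [1, 2^{1/q}]`. -/
theorem softMin_div_min_mem_Icc {q a b : ℝ} (hq : 0 < q) (ha : 0 < a) (hb : 0 < b) :
    softMin q a b / min a b ∈ Set.Icc (1 : ℝ) (2 ^ (1 / q)) := by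
  have hmin : 0 < min a b := lt_min ha hb
  constructor
  · rw [le_div_iff₀ hmin, one_mul]
    exact min_le_softMin hq ha hb
  · rw [div_le_iff₀ hmin]
    exact softMin_le_mul_min hq ha hb

/-- The READING direction: a value certified BELOW the soft objective certifies a floor under the true minimum of
the two smooth ratios, `x ≤ softMin q a b ⟹ x / 2^{1/q} ≤ min a b`. -/
theorem le_min_of_le_softMin {q a b x : ℝ} (hq : 0 < q) (ha : 0 < a) (hb : 0 < b)
    (hx : x ≤ softMin q a b) : x / 2 ^ (1 / q) ≤ min a b := by
  have h2 : 0 < (2 : ℝ) ^ (1 / q) := Real.rpow_pos_of_pos (by norm_num) _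
  rw [div_le_iff₀ h2, mul_comm]
  exact hx.trans (softMin_le_mul_min hq ha hb)

/-- Conversely a ceiling on the soft objective is a ceiling on the minimum: `softMin q a b ≤ y ⟹ min a b ≤ y`. -/
theorem min_le_of_softMin_le {q a b y : ℝ} (hq : 0 < q) (ha : 0 < a) (hb : 0 < b)
    (hy : softMin q a b ≤ y) : min a b ≤ y :=
  (min_le_softMin hq ha hb).trans hy

/-- Ascending the first ratio ascends the soft minimum: `a ≤ a' ⟹ softMin q a b ≤ softMin q a' b`. -/
theorem softMin_mono_left {q a a' b : ℝ} (hq : 0 < q) (ha : 0 < a) (hb : 0 < b) (haa' : a ≤ a') :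
    softMin q a b ≤ softMin q a' b := by
  have ha' : 0 < a' := lt_of_lt_of_le ha haa'
  have hz : -(1 / q) ≤ 0 := by
    have : 0 < 1 / q := by positivity
    linarith
  have hA'A : a' ^ (-q) ≤ a ^ (-q) := Real.rpow_le_rpow_of_nonpos ha haa' (by linarith)
  have hB : 0 < b ^ (-q) := Real.rpow_pos_of_pos hb _
  have hA' : 0 < a' ^ (-q) := Real.rpow_pos_of_pos ha' _
  have hm'm : (a' ^ (-q) + b ^ (-q)) / 2 ≤ (a ^ (-q) + b ^ (-q)) / 2 := by linarith
  unfold softMin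
  exact Real.rpow_le_rpow_of_nonpos (by positivity) hm'm hz

/-- Ascending the second ratio ascends the soft minimum: `b ≤ b' ⟹ softMin q a b ≤ softMin q a b'`. -/
theorem softMin_mono_right {q a b b' : ℝ} (hq : 0 < q) (ha : 0 < a) (hb : 0 < b) (hbb' : b ≤ b') :
    softMin q a b ≤ softMin q a b' := by
  rw [softMin_comm q a b, softMin_comm q a b']
  exact softMin_mono_left hq hb ha hbb'

/-- Degree-one homogeneity: `softMin q (c a) (c b) = c · softMin q a b` for `0 < c` — rescaling both level ratios
by a common factor rescales the objective (so the bracket is a statement about the RATIO `J / min` only). -/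
theorem softMin_mul {q a b c : ℝ} (hq : q ≠ 0) (ha : 0 ≤ a) (hb : 0 ≤ b) (hc : 0 < c) :
    softMin q (c * a) (c * b) = c * softMin q a b := by
  unfold softMin
  have hC : 0 ≤ c ^ (-q) := Real.rpow_nonneg hc.le _
  have hA : 0 ≤ a ^ (-q) := Real.rpow_nonneg ha _
  have hB : 0 ≤ b ^ (-q) := Real.rpow_nonneg hb _
  rw [Real.mul_rpow hc.le ha, Real.mul_rpow hc.le hb,
    show (c ^ (-q) * a ^ (-q) + c ^ (-q) * b ^ (-q)) / 2 = c ^ (-q) * ((a ^ (-q) + b ^ (-q)) / 2) by ring,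
    Real.mul_rpow hC (by positivity), rpow_neg_rpow_neg_one_div hq hc.le]

/-! ## The soft maximum: normalised log-sum-exp over a finite index set (the time samples) -/

variable {ι : Type*}

/-- The normalised log-sum-exp (soft maximum with inverse temperature `β`) of `f` over a finite set `s`:
`logMeanExp β s f = log((∑_{i∈s} exp(β fᵢ)) / #s) / β` — the `A_lse` keys of the relay plugin (the MEAN
normalisation is the one whose value never exceeds the true maximum, as the printed `A1_lse ≤ A1_max` shows). -/
def logMeanExp (β : ℝ) (s : Finset ι) (f : ι → ℝ) : ℝ :=
  Real.log ((∑ i ∈ s, Real.exp (β * f i)) / s.card) / β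

/-- On a constant profile the soft maximum is exact. -/
theorem logMeanExp_const {β : ℝ} (hβ : β ≠ 0) {s : Finset ι} (hs : s.Nonempty) (c : ℝ) :
    logMeanExp β s (fun _ => c) = c := by
  unfold logMeanExp
  have hcard : (0 : ℝ) < s.card := by exact_mod_cast hs.card_pos
  rw [Finset.sum_const, nsmul_eq_mul, mul_div_cancel_left₀ _ hcard.ne', Real.log_exp,
    mul_div_cancel_left₀ _ hβ]

/-- The soft maximum never exceeds the maximum: `logMeanExp β s f ≤ max_{i∈s} fᵢ` (`0 < β`). -/
theorem logMeanExp_le_sup' {β : ℝ} (hβ : 0 < β) {s : Finset ι} (hs : s.Nonempty) (f : ι → ℝ) :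
    logMeanExp β s f ≤ s.sup' hs f := by
  unfold logMeanExp
  have hcard : (0 : ℝ) < s.card := by exact_mod_cast hs.card_pos
  have hsum_le : ∑ i ∈ s, Real.exp (β * f i) ≤ s.card • Real.exp (β * s.sup' hs f) := by
    refine Finset.sum_le_card_nsmul s _ _ (fun i hi => ?_)
    exact Real.exp_le_exp.mpr (mul_le_mul_of_nonneg_left (Finset.le_sup' f hi) hβ.le)
  rw [nsmul_eq_mul] at hsum_le
  have hpos : 0 < (∑ i ∈ s, Real.exp (β * f i)) / s.card := by
    have : 0 < ∑ i ∈ s, Real.exp (β * f i) := Finset.sum_pos (fun i _ => Real.exp_pos _) hs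
    positivity
  have hmean : (∑ i ∈ s, Real.exp (β * f i)) / s.card ≤ Real.exp (β * s.sup' hs f) := by
    rw [div_le_iff₀ hcard, mul_comm]
    exact hsum_le
  have hlog : Real.log ((∑ i ∈ s, Real.exp (β * f i)) / s.card) ≤ β * s.sup' hs f := by
    rw [Real.log_le_iff_le_exp hpos]
    exact hmean
  rw [div_le_iff₀ hβ, mul_comm]
  exact hlog

/-- The soft maximum loses at most `log #s / β` against the maximum:
`max_{i∈s} fᵢ − log(#s)/β ≤ logMeanExp β s f` (`0 < β`) — the price of the mean normalisation, small once
`β · (spread of f)` dominates `log` of the number of time samples. -/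
theorem sup'_sub_le_logMeanExp {β : ℝ} (hβ : 0 < β) {s : Finset ι} (hs : s.Nonempty) (f : ι → ℝ) :
    s.sup' hs f - Real.log s.card / β ≤ logMeanExp β s f := by
  unfold logMeanExp
  have hcard : (0 : ℝ) < s.card := by exact_mod_cast hs.card_pos
  obtain ⟨i, hi, hfi⟩ := Finset.exists_mem_eq_sup' hs f
  have hsingle : Real.exp (β * f i) ≤ ∑ j ∈ s, Real.exp (β * f j) :=
    Finset.single_le_sum (fun j _ => (Real.exp_pos (β * f j)).le) hi
  have hpos : 0 < (∑ j ∈ s, Real.exp (β * f j)) / s.card := by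
    have : 0 < ∑ j ∈ s, Real.exp (β * f j) := Finset.sum_pos (fun j _ => Real.exp_pos _) hs
    positivity
  have hmean : Real.exp (β * f i - Real.log s.card) ≤ (∑ j ∈ s, Real.exp (β * f j)) / s.card := by
    rw [Real.exp_sub, Real.exp_log hcard]
    exact div_le_div_of_nonneg_right hsingle hcard.le
  have hlog : β * f i - Real.log s.card ≤ Real.log ((∑ j ∈ s, Real.exp (β * f j)) / s.card) := by
    rw [Real.le_log_iff_exp_le hpos]
    exact hmean
  rw [hfi, le_div_iff₀ hβ, sub_mul, div_mul_cancel₀ _ hβ.ne', mul_comm]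
  exact hlog

/-- The soft maximum is monotone in the profile: `f ≤ g` on `s` ⟹ `logMeanExp β s f ≤ logMeanExp β s g` (`0 < β`). -/
theorem logMeanExp_mono {β : ℝ} (hβ : 0 < β) {s : Finset ι} (hs : s.Nonempty) {f g : ι → ℝ}
    (hfg : ∀ i ∈ s, f i ≤ g i) : logMeanExp β s f ≤ logMeanExp β s g := by
  unfold logMeanExp
  have hcard : (0 : ℝ) < s.card := by exact_mod_cast hs.card_pos
  have hposf : 0 < ∑ i ∈ s, Real.exp (β * f i) := Finset.sum_pos (fun i _ => Real.exp_pos _) hs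
  have hsum : ∑ i ∈ s, Real.exp (β * f i) ≤ ∑ i ∈ s, Real.exp (β * g i) :=
    Finset.sum_le_sum (fun i hi => Real.exp_le_exp.mpr (mul_le_mul_of_nonneg_left (hfg i hi) hβ.le))
  refine div_le_div_of_nonneg_right ?_ hβ.le
  exact Real.log_le_log (by positivity) (div_le_div_of_nonneg_right hsum hcard.le)

/-- Transfer of the time bracket to a level ratio: if the soft-max numerator `Aℓ` satisfies
`Am − L ≤ Aℓ ≤ Am` (with `L = log #s / β`) then the smooth ratio `Aℓ / D` (denominator `D = λ · B > 0`) satisfies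
`Am / D − L / D ≤ Aℓ / D ≤ Am / D`. -/
theorem ratio_bracket {Aℓ Am L D : ℝ} (hD : 0 < D) (hlo : Am - L ≤ Aℓ) (hhi : Aℓ ≤ Am) :
    Am / D - L / D ≤ Aℓ / D ∧ Aℓ / D ≤ Am / D := by
  constructor
  · rw [← sub_div]
    exact div_le_div_of_nonneg_right hlo hD.le
  · exact div_le_div_of_nonneg_right hhi hD.le

/-! ## Numeric anchors at the registered order `q = 12` -/

/-- `2^{1/12} < 1.06`: at the registered order `q = 12` the soft minimum over-states the smaller smooth ratio by
less than `6 %` (opt-adj prints `pm_bracket_q = 1.05946…`). -/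
theorem two_rpow_one_div_twelve_lt : (2 : ℝ) ^ (1 / 12 : ℝ) < 1.06 := by
  have h : (1 / 12 : ℝ) = (12 : ℝ)⁻¹ := by norm_num
  rw [h, Real.rpow_inv_lt_iff_of_pos (by norm_num) (by norm_num) (by norm_num)]
  have h12 : (1.06 : ℝ) ^ (12 : ℝ) = (1.06 : ℝ) ^ (12 : ℕ) := by
    rw [show (12 : ℝ) = ((12 : ℕ) : ℝ) by norm_num, Real.rpow_natCast]
  rw [h12]
  norm_num

/-- The registered bracket at `q = 12` in the form the readings use: for positive smooth ratios,
`min(ρ₁, ρ₂) ≤ J ≤ 1.06 · min(ρ₁, ρ₂)` with `J = softMin 12 ρ₁ ρ₂`. -/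
theorem relay_bracket_twelve {ρ₁ ρ₂ : ℝ} (h₁ : 0 < ρ₁) (h₂ : 0 < ρ₂) :
    min ρ₁ ρ₂ ≤ softMin 12 ρ₁ ρ₂ ∧ softMin 12 ρ₁ ρ₂ ≤ 1.06 * min ρ₁ ρ₂ := by
  refine ⟨min_le_softMin (by norm_num) h₁ h₂, ?_⟩
  have hmin : 0 < min ρ₁ ρ₂ := lt_min h₁ h₂
  have h := softMin_le_mul_min (q := 12) (by norm_num) h₁ h₂
  have hb : (2 : ℝ) ^ (1 / 12 : ℝ) * min ρ₁ ρ₂ ≤ 1.06 * min ρ₁ ρ₂ :=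
    mul_le_mul_of_nonneg_right two_rpow_one_div_twelve_lt.le hmin.le
  exact h.trans hb

/-- Design (b)'s printed numbers sit inside the bracket: `J = 0.56464`, `min(ρ₁, ρ₂) = 0.55071`,
`J / min = 1.0253 ∈ [1, 1.06)`. -/
example : (0.55071 : ℝ) ≤ 0.56464 ∧ (0.56464 : ℝ) < 1.06 * 0.55071 := by norm_num

/-! ### Zero-temperature limits (p1 gen 7 append, 2026-08-25)

Both surrogates recover the true extremum as their order grows: the over-statement factor `2^{1/q}` of the soft
minimum and the mean-normalisation price `log #s / β` of the soft maximum vanish, so the registered brackets squeeze.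
This is the sense in which the order (`q = 12`, `β` of the plugin) trades smoothness of the ascent objective against
fidelity to the weakest level / the true peak, with an explicit price at every finite order. -/

/-- The over-statement factor disappears at zero temperature: `2^{1/q} → 1` as `q → ∞`. -/
theorem tendsto_two_rpow_one_div :
    Filter.Tendsto (fun q : ℝ => (2 : ℝ) ^ (1 / q)) Filter.atTop (nhds 1) := by
  have h1 : Filter.Tendsto (fun q : ℝ => Real.log 2 * q⁻¹) Filter.atTop (nhds (Real.log 2 * 0)) :=
    tendsto_inv_atTop_zero.const_mul _
  rw [mul_zero] at h1
  have h2 : Filter.Tendsto (fun q : ℝ => Real.exp (Real.log 2 * q⁻¹)) Filter.atTop (nhds (Real.exp 0)) :=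
    (Real.continuous_exp.tendsto 0).comp h1
  rw [Real.exp_zero] at h2
  refine h2.congr (fun q => ?_)
  rw [Real.rpow_def_of_pos (by norm_num : (0 : ℝ) < 2), one_div]

/-- ZERO-TEMPERATURE LIMIT of the registered surrogate: `softMin q a b → min a b` as `q → ∞` (`0 < a`, `0 < b`),
squeezed in the bracket `min a b ≤ softMin q a b ≤ 2^{1/q} · min a b`. -/
theorem tendsto_softMin_atTop {a b : ℝ} (ha : 0 < a) (hb : 0 < b) :
    Filter.Tendsto (fun q : ℝ => softMin q a b) Filter.atTop (nhds (min a b)) := by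
  have hup : Filter.Tendsto (fun q : ℝ => (2 : ℝ) ^ (1 / q) * min a b) Filter.atTop (nhds (min a b)) := by
    simpa only [one_mul] using tendsto_two_rpow_one_div.mul_const (min a b)
  refine tendsto_of_tendsto_of_tendsto_of_le_of_le' tendsto_const_nhds hup ?_ ?_
  · filter_upwards [Filter.eventually_gt_atTop (0 : ℝ)] with q hq using min_le_softMin hq ha hb
  · filter_upwards [Filter.eventually_gt_atTop (0 : ℝ)] with q hq using softMin_le_mul_min hq ha hb

/-- The mean-normalisation price vanishes at zero temperature: `log #s / β → 0` as `β → ∞`. -/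
theorem tendsto_log_card_div_atTop (s : Finset ι) :
    Filter.Tendsto (fun β : ℝ => Real.log s.card / β) Filter.atTop (nhds 0) := by
  simpa only [div_eq_mul_inv, mul_zero] using tendsto_inv_atTop_zero.const_mul (Real.log s.card)

/-- ZERO-TEMPERATURE LIMIT of the soft maximum: `logMeanExp β s f → max_{i∈s} fᵢ` as `β → ∞`, squeezed in the
bracket `max f − log #s / β ≤ logMeanExp β s f ≤ max f`. -/
theorem tendsto_logMeanExp_atTop {s : Finset ι} (hs : s.Nonempty) (f : ι → ℝ) :
    Filter.Tendsto (fun β : ℝ => logMeanExp β s f) Filter.atTop (nhds (s.sup' hs f)) := by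
  have hlo : Filter.Tendsto (fun β : ℝ => s.sup' hs f - Real.log s.card / β) Filter.atTop
      (nhds (s.sup' hs f)) := by
    simpa only [sub_zero] using tendsto_const_nhds.sub (tendsto_log_card_div_atTop s)
  refine tendsto_of_tendsto_of_tendsto_of_le_of_le' hlo tendsto_const_nhds ?_ ?_
  · filter_upwards [Filter.eventually_gt_atTop (0 : ℝ)] with β hβ using sup'_sub_le_logMeanExp hβ hs f
  · filter_upwards [Filter.eventually_gt_atTop (0 : ℝ)] with β hβ using logMeanExp_le_sup' hβ hs f

/-! ### Monotonicity of the soft maximum in its inverse temperature (p1 gen 7, second append)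
`logMeanExp β s f` = log of the power mean of order `β` of the `exp fᵢ`, and power means increase with their order
(Jensen), so a larger `β` reads higher — still below the true maximum (`logMeanExp_le_sup'`); dually the power-mean soft
minimum is antitone in its order. One import is added for Jensen's inequality (`Mathlib.Analysis.MeanInequalitiesPow`). -/

/-- The soft maximum is monotone in the inverse temperature: `0 < β ≤ β' ⟹ logMeanExp β s f ≤ logMeanExp β' s f`. -/
theorem logMeanExp_mono_beta {β β' : ℝ} (hβ : 0 < β) (hββ' : β ≤ β') {s : Finset ι} (hs : s.Nonempty)
    (f : ι → ℝ) : logMeanExp β s f ≤ logMeanExp β' s f := by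
  have hβ' : 0 < β' := hβ.trans_le hββ'
  have hcard : (0 : ℝ) < s.card := by exact_mod_cast hs.card_pos
  set p : ℝ := β' / β with hp_def
  have hp : 1 ≤ p := by rw [hp_def, le_div_iff₀ hβ, one_mul]; exact hββ'
  set A : ℝ := (∑ i ∈ s, Real.exp (β * f i)) / s.card with hA_def
  set B : ℝ := (∑ i ∈ s, Real.exp (β' * f i)) / s.card with hB_def
  have hA : 0 < A := div_pos (Finset.sum_pos (fun i _ => Real.exp_pos _) hs) hcard
  -- Jensen: A^p ≤ B
  have hJ : A ^ p ≤ B := by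
    have hw : ∀ i ∈ s, (0 : ℝ) ≤ 1 / s.card := fun _ _ => by positivity
    have hw' : ∑ i ∈ s, (1 : ℝ) / s.card = 1 := by
      rw [Finset.sum_const, nsmul_eq_mul]; field_simp
    have hz : ∀ i ∈ s, (0 : ℝ) ≤ Real.exp (β * f i) := fun i _ => (Real.exp_pos _).le
    have h := Real.rpow_arith_mean_le_arith_mean_rpow s (fun _ => (1 : ℝ) / s.card) _ hw hw' hz hp
    have hAe : ∑ i ∈ s, (1 : ℝ) / s.card * Real.exp (β * f i) = A := by
      rw [hA_def, ← Finset.mul_sum]; ring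
    have hBe : ∑ i ∈ s, (1 : ℝ) / s.card * Real.exp (β * f i) ^ p = B := by
      have hterm : ∀ i ∈ s, (1 : ℝ) / s.card * Real.exp (β * f i) ^ p = (1 : ℝ) / s.card * Real.exp (β' * f i) := by
        intro i _
        rw [← Real.exp_mul]
        have : β * f i * p = β' * f i := by rw [hp_def]; field_simp
        rw [this]
      rw [Finset.sum_congr rfl hterm, ← Finset.mul_sum, hB_def]
      ring
    rw [hAe, hBe] at h
    exact h
  -- logarithms: p · log A ≤ log B, and log A / β = p · log A / β'
  have hlog : p * Real.log A ≤ Real.log B := by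
    rw [← Real.log_rpow hA]
    exact Real.log_le_log (Real.rpow_pos_of_pos hA _) hJ
  have key : Real.log A / β = p * Real.log A / β' := by
    rw [hp_def]; field_simp
  unfold logMeanExp
  rw [← hA_def, ← hB_def, key]
  exact div_le_div_of_nonneg_right hlog hβ'.le

end Summit.NavierStokesRegularity.FluidComputer.SoftExtrema

end
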